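import Literature.Analysis.FluidPDE.MillerStrainDeterminantBound
import HarnessLib

/-!
# Crux `Target` = `TypeICertificateLadder.NoTypeIBlowup` (stmt-NavierStokesRegularity-1217), line
# `depletion-ladder`: POINTWISE ALGEBRA OF THE STRAIN-CUBE DEPLETION BOUND

`--supports stmt-NavierStokesRegularity-1217` (first file of the seat's proof of the depletion
constant `κ = (√3+√6)/9 < 1/2` — stub S1 `stub_depletionBelowHalf` in the Tao-slice class — and of
RUNG TWO of the amplitude ladder).

For a trace-free `3 × 3` array `g` (the velocity gradient `gᵢⱼ = ∂ⱼvᵢ`), its symmetric part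
`sᵢⱼ = ½(gᵢⱼ + gⱼᵢ)` (the strain) and its vorticity vector
`w = (g₂₁ − g₁₂, g₀₂ − g₂₀, g₁₀ − g₀₁)` (`= curl v`, tree `curl_eq_stdMatrix`), all passed as
arrays with their defining equations (no new definitions):

* `vortStretch_eq_four_det_sub` — **Betchov–Miller pointwise**: `Σᵢⱼ wᵢ gᵢⱼ wⱼ = 4 det g − 4 det s`
  (from `tr g³ = tr s³ + ¾ wᵀ s w`, `tr g³ = 3 det g`, `tr s³ = 3 det s` for trace-free arrays).
* `sum_mul_sym_eq`, `sum_sq_sym_eq` — `⟪g, s⟫ = |s|²`, `|s|² = |g|² − ½|w|²`.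
* `abs_four_det_sym_le` — Miller's determinant bound (tree `Miller2019.neg_four_mul_det_le`,
  Prop. 4.8 of Miller 2020) in the two-sided form `|4 det s| ≤ (2√6/9)|s|²√(|s|²)`.
* `vortStretch_le_four_det_add`, `four_det_sub_le_vortStretch` — the pointwise production bound
  `|Σ wᵢgᵢⱼwⱼ − 4 det g| ≤ (2√6/9)|s|³`; integrated against `∫ det ∇v = 0` (tree
  `integral_det_fderiv_eq_zero`) it gives `∫⟪ω, Dv ω⟫ ≤ (2√6/9)∫|S|³` on `ℝ³` (sequel file).
* `sq_sum_three_mul_le`, `sq_sum_sum_mul_le`, `sq_sum_mul_sum_mul_le` — the Cauchy–Schwarz steps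
  of the cube interpolation `∫|S|³ ≤ ‖v‖_∞ (½‖Δv‖₂‖S‖₂ + ‖S‖₂‖∇S‖₂)` (sequel file).

Pure finite algebra (`Fin 3` sums, `Matrix.det_fin_three`, `ring`/`nlinarith`); no analysis.
WHAT THIS IS NOT: no integral statement; the depletion constant and the rung are in the sequel files.

References: R. Betchov, J. Fluid Mech. 1 (1956) 497–504; E. Miller, Arch. Ration. Mech. Anal. 237
(2020), Prop. 4.8 (arXiv:1710.05569). [cite: Miller2019, Prop. 4.8]
-/

noncomputable section

open Finset Matrix

namespace Summit.NavierStokesRegularity.NavierStokesRegularity.Theorems.DepletionLadder.StrainCube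

-- the problem directory repeats the summit name (`NavierStokesRegularity/NavierStokesRegularity`)
set_option linter.dupNamespace false

variable (g s : Fin 3 → Fin 3 → ℝ) (w : Fin 3 → ℝ)

/-- The symmetric part as a matrix is symmetric. [folklore] -/
theorem isSymm_of_sym (hs : ∀ i j, s i j = (g i j + g j i) / 2) :
    (Matrix.of fun i j => s i j).IsSymm := by
  ext i j
  simp only [transpose_apply, of_apply]
  rw [hs i j, hs j i]; ring

/-- The symmetric part of a trace-free array is trace free. [folklore] -/
theorem trace_of_sym (hs : ∀ i j, s i j = (g i j + g j i) / 2) (htr : g 0 0 + g 1 1 + g 2 2 = 0) :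
    (Matrix.of fun i j => s i j).trace = 0 := by
  rw [Matrix.trace_fin_three]
  simp only [of_apply]
  rw [hs 0 0, hs 1 1, hs 2 2]
  linarith

/-- **Betchov–Miller, pointwise**: for a trace-free array `g` with symmetric part `s` and vorticity
vector `w`, the vortex-stretching density is `Σᵢⱼ wᵢ gᵢⱼ wⱼ = 4 det g − 4 det s`. [folklore] -/
theorem vortStretch_eq_four_det_sub (hs : ∀ i j, s i j = (g i j + g j i) / 2)
    (hw0 : w 0 = g 2 1 - g 1 2) (hw1 : w 1 = g 0 2 - g 2 0) (hw2 : w 2 = g 1 0 - g 0 1)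
    (htr : g 0 0 + g 1 1 + g 2 2 = 0) :
    ∑ i, ∑ j, w i * g i j * w j =
      4 * (Matrix.of fun i j => g i j).det - 4 * (Matrix.of fun i j => s i j).det := by
  rw [Matrix.det_fin_three, Matrix.det_fin_three]
  simp only [Fin.sum_univ_three, of_apply]
  rw [hs 0 0, hs 0 1, hs 0 2, hs 1 0, hs 1 1, hs 1 2, hs 2 0, hs 2 1, hs 2 2, hw0, hw1, hw2]
  have h00 : g 0 0 = -(g 1 1 + g 2 2) := by linarith
  rw [h00]
  ring

/-- `⟪g, s⟫ = |s|²`: `Σᵢⱼ gᵢⱼ sᵢⱼ = Σᵢⱼ sᵢⱼ²`. [folklore] -/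
theorem sum_mul_sym_eq (hs : ∀ i j, s i j = (g i j + g j i) / 2) :
    ∑ i, ∑ j, g i j * s i j = ∑ i, ∑ j, s i j ^ 2 := by
  simp only [Fin.sum_univ_three]
  rw [hs 0 0, hs 0 1, hs 0 2, hs 1 0, hs 1 1, hs 1 2, hs 2 0, hs 2 1, hs 2 2]
  ring

/-- `|s|² = |g|² − ½|w|²`. [folklore] -/
theorem sum_sq_sym_eq (hs : ∀ i j, s i j = (g i j + g j i) / 2)
    (hw0 : w 0 = g 2 1 - g 1 2) (hw1 : w 1 = g 0 2 - g 2 0) (hw2 : w 2 = g 1 0 - g 0 1) :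
    ∑ i, ∑ j, s i j ^ 2 = (∑ i, ∑ j, g i j ^ 2) - (∑ k, w k ^ 2) / 2 := by
  simp only [Fin.sum_univ_three]
  rw [hs 0 0, hs 0 1, hs 0 2, hs 1 0, hs 1 1, hs 1 2, hs 2 0, hs 2 1, hs 2 2, hw0, hw1, hw2]
  ring

/-- `|s|² ≤ |g|²`. [folklore] -/
theorem sum_sq_sym_le (hs : ∀ i j, s i j = (g i j + g j i) / 2) :
    ∑ i, ∑ j, s i j ^ 2 ≤ ∑ i, ∑ j, g i j ^ 2 := by
  simp only [Fin.sum_univ_three]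
  rw [hs 0 0, hs 0 1, hs 0 2, hs 1 0, hs 1 1, hs 1 2, hs 2 0, hs 2 1, hs 2 2]
  nlinarith [sq_nonneg (g 0 1 - g 1 0), sq_nonneg (g 0 2 - g 2 0), sq_nonneg (g 1 2 - g 2 1)]

/-- **Miller's determinant bound, two-sided** (Miller 2020 Prop. 4.8, tree
`Miller2019.neg_four_mul_det_le`, applied to `s` and `−s`): for the symmetric part `s` of a
trace-free array, `|4 det s| ≤ (2√6/9) |s|² √(|s|²)`. [cite: Miller2019, Prop. 4.8] -/
theorem abs_four_det_sym_le (hs : ∀ i j, s i j = (g i j + g j i) / 2)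
    (htr : g 0 0 + g 1 1 + g 2 2 = 0) :
    |4 * (Matrix.of fun i j => s i j).det| ≤
      (2 / 9) * Real.sqrt 6 * ((∑ i, ∑ j, s i j ^ 2) * Real.sqrt (∑ i, ∑ j, s i j ^ 2)) := by
  set S : Matrix (Fin 3) (Fin 3) ℝ := Matrix.of fun i j => s i j with hS
  have hsym : S.IsSymm := isSymm_of_sym g s hs
  have htrS : S.trace = 0 := trace_of_sym g s hs htr
  have hF : ∑ i, ∑ j, S i j ^ 2 = ∑ i, ∑ j, s i j ^ 2 := by simp [hS]
  -- lower sign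
  have h1 := Literature.Analysis.FluidPDE.Miller2019.neg_four_mul_det_le S hsym htrS
  rw [hF] at h1
  -- upper sign, via `−S`
  have hsym' : (-S).IsSymm := hsym.neg
  have htrS' : (-S).trace = 0 := by rw [Matrix.trace_neg, htrS, neg_zero]
  have h2 := Literature.Analysis.FluidPDE.Miller2019.neg_four_mul_det_le (-S) hsym' htrS'
  have hdet : (-S).det = -S.det := by
    rw [Matrix.det_neg, Fintype.card_fin]; ring
  have hF' : ∑ i, ∑ j, (-S) i j ^ 2 = ∑ i, ∑ j, s i j ^ 2 := by
    rw [← hF]; simp only [Matrix.neg_apply, neg_sq]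
  rw [hdet, hF'] at h2
  rw [abs_le]
  constructor <;> linarith

/-- **Pointwise production bound, upper**: `Σ wᵢgᵢⱼwⱼ ≤ 4 det g + (2√6/9)|s|²√(|s|²)`. [folklore] -/
theorem vortStretch_le_four_det_add (hs : ∀ i j, s i j = (g i j + g j i) / 2)
    (hw0 : w 0 = g 2 1 - g 1 2) (hw1 : w 1 = g 0 2 - g 2 0) (hw2 : w 2 = g 1 0 - g 0 1)
    (htr : g 0 0 + g 1 1 + g 2 2 = 0) :
    ∑ i, ∑ j, w i * g i j * w j ≤
      4 * (Matrix.of fun i j => g i j).det +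
        (2 / 9) * Real.sqrt 6 * ((∑ i, ∑ j, s i j ^ 2) * Real.sqrt (∑ i, ∑ j, s i j ^ 2)) := by
  rw [vortStretch_eq_four_det_sub g s w hs hw0 hw1 hw2 htr]
  have h := abs_four_det_sym_le g s hs htr
  rw [abs_le] at h
  linarith [h.1]

/-- **Pointwise production bound, lower**: `4 det g − (2√6/9)|s|²√(|s|²) ≤ Σ wᵢgᵢⱼwⱼ`. [folklore] -/
theorem four_det_sub_le_vortStretch (hs : ∀ i j, s i j = (g i j + g j i) / 2)
    (hw0 : w 0 = g 2 1 - g 1 2) (hw1 : w 1 = g 0 2 - g 2 0) (hw2 : w 2 = g 1 0 - g 0 1)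
    (htr : g 0 0 + g 1 1 + g 2 2 = 0) :
    4 * (Matrix.of fun i j => g i j).det -
        (2 / 9) * Real.sqrt 6 * ((∑ i, ∑ j, s i j ^ 2) * Real.sqrt (∑ i, ∑ j, s i j ^ 2)) ≤
      ∑ i, ∑ j, w i * g i j * w j := by
  rw [vortStretch_eq_four_det_sub g s w hs hw0 hw1 hw2 htr]
  have h := abs_four_det_sym_le g s hs htr
  rw [abs_le] at h
  linarith [h.2]

/-- Cauchy–Schwarz on `3` terms. [folklore] -/
theorem sq_sum_three_mul_le (a b : Fin 3 → ℝ) :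
    (∑ i, a i * b i) ^ 2 ≤ (∑ i, a i ^ 2) * (∑ i, b i ^ 2) := by
  simp only [Fin.sum_univ_three]
  nlinarith [sq_nonneg (a 0 * b 1 - a 1 * b 0), sq_nonneg (a 0 * b 2 - a 2 * b 0),
    sq_nonneg (a 1 * b 2 - a 2 * b 1)]

/-- Cauchy–Schwarz on `3 × 3` terms: `(Σᵢⱼ sᵢⱼ dᵢⱼ)² ≤ (Σ sᵢⱼ²)(Σ dᵢⱼ²)`. [folklore] -/
theorem sq_sum_sum_mul_le (d : Fin 3 → Fin 3 → ℝ) :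
    (∑ i, ∑ j, s i j * d i j) ^ 2 ≤ (∑ i, ∑ j, s i j ^ 2) * (∑ i, ∑ j, d i j ^ 2) := by
  have key := Finset.sum_mul_sq_le_sq_mul_sq (Finset.univ : Finset (Fin 3 × Fin 3))
    (fun p => s p.1 p.2) (fun p => d p.1 p.2)
  simp only [Fintype.sum_prod_type] at key
  exact key

/-- The `S ∇N` step: `(Σᵢ uᵢ Σⱼ sᵢⱼ zⱼ)² ≤ (Σᵢ uᵢ²)·(Σᵢⱼ sᵢⱼ²)·(Σⱼ zⱼ²)`. [folklore] -/
theorem sq_sum_mul_sum_mul_le (u z : Fin 3 → ℝ) :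
    (∑ i, u i * ∑ j, s i j * z j) ^ 2 ≤ (∑ i, u i ^ 2) * (∑ i, ∑ j, s i j ^ 2) * (∑ j, z j ^ 2) := by
  have h1 := sq_sum_three_mul_le u (fun i => ∑ j, s i j * z j)
  have h2 : ∀ i, (∑ j, s i j * z j) ^ 2 ≤ (∑ j, s i j ^ 2) * (∑ j, z j ^ 2) :=
    fun i => sq_sum_three_mul_le (s i) z
  have h3 : ∑ i, (∑ j, s i j * z j) ^ 2 ≤ (∑ i, ∑ j, s i j ^ 2) * (∑ j, z j ^ 2) := by
    rw [Finset.sum_mul]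
    exact Finset.sum_le_sum fun i _ => h2 i
  have hu : 0 ≤ ∑ i, u i ^ 2 := sum_nonneg fun _ _ => sq_nonneg _
  calc (∑ i, u i * ∑ j, s i j * z j) ^ 2 ≤ (∑ i, u i ^ 2) * ∑ i, (∑ j, s i j * z j) ^ 2 := h1
    _ ≤ (∑ i, u i ^ 2) * ((∑ i, ∑ j, s i j ^ 2) * (∑ j, z j ^ 2)) :=
        mul_le_mul_of_nonneg_left h3 hu
    _ = (∑ i, u i ^ 2) * (∑ i, ∑ j, s i j ^ 2) * (∑ j, z j ^ 2) := by ring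

end Summit.NavierStokesRegularity.NavierStokesRegularity.Theorems.DepletionLadder.StrainCube

end
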